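import Summits.BirchSwinnertonDyer.BirchSwinnertonDyer.Theorems.BiquadraticEisensteinDescentHeegnerTwistCouplingInSupplyDisjointDivisibility
import Summits.BirchSwinnertonDyer.BirchSwinnertonDyer.Theorems.BiquadraticEisensteinDescentDisjointDivisibilityResidues
import Literature.NumberTheory.EllipticCurves.HeegnerHypothesisKroneckerProofs
import Literature.NumberTheory.QuadraticFields.FundamentalDiscriminant
import Literature.NumberTheory.QuadraticFields.ImaginaryQuadraticPrescribedSplitting
import Literature.NumberTheory.QuadraticFields.ThreeTorsionMeanSquarefreeCount
import Literature.NumberTheory.QuadraticFields.ThreeTorsionMeanSquarefreeEuler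
import Mathlib.Analysis.Real.Pi.Bounds
import HarnessLib

set_option linter.dupNamespace false -- `Summit.BirchSwinnertonDyer.BirchSwinnertonDyer.Theorems.…` (summit = sub)
set_option autoImplicit false

/-!
# Route `BiquadraticEisensteinDescent`, crux `HeegnerTwistCouplingInSupply` (stmt-BirchSwinnertonDyer-21381) —
# crux idea `disjoint-divisibility-pigeonhole`: effective counts of Heegner discriminants in residue classes (for S3)

Cell `pub/bsd-wall`, width-prover seat `bsd-wall-cm-bed-w4` g24 (explicit-unit, `--supports stmt-BirchSwinnertonDyer-21381`
as helper). Second of three files PROVING the card's density step S3 = `HeegnerSplitDensity` (typed in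
`…DisjointDivisibilityDefs.lean`; the card calls it a Pólya–Vinogradov step — it is in fact elementary): residues in
`…DisjointDivisibilityResidues.lean`, the final inequality in `…HeegnerSplitDensity.lean`. Everything is EFFECTIVE (explicit
constants, no asymptotics), which is what the card's block argument at height `Y = (N₀(2P)²)^A` needs.

PROVED here (`A_N(Y) = ambient N Y`, the Heegner discriminants `d ∈ [−Y, −5]` for `N`; `M = 8N₀`; a residue `c (mod M)` is
ADMISSIBLE when `(c/q) = 1` for every odd prime `q ∣ N₀`; `g` = number of admissible `c ≡ 1 (mod 8)`):

* §1 `three_fifths_le_density` (`(6/π²)∏_{q∣L}(1−q⁻²)⁻¹ ≥ 3/5`), `height_ineq` (`Y ≥ (N₀p²)^{10} ⇒ (Y−4)/(8N₀) ≥ 14p√Y + 1`);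
* §2 UPPER family: `ambient_subset_biUnion` — every `d ∈ A_{N₀}(Y)` reduces mod `8N₀` to an admissible class (`≡ 1 (8)` if
  `2 ∣ N₀`) by the decomposition law `satisfiesHeegnerHypothesis_iff_kronecker`; `card_admissible_le` (those classes are
  `≤ 8g`: odd `N₀` by the shift lemma, even `N₀` trivially); **`card_ambient_le : #A_{N₀}(Y) ≤ 8g·((Y−4)/(8N₀) + 1)`**
  (tree `abs_card_Ico_filter_modEq_sub_le`);
* §3 LOWER family: `filter_modEq_squarefree_subset_ambient` — for `8 ∣ L` and a GOOD class `c` (`c ≡ 1 (8)`; `q ∣ L`,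
  `(c/q) = 1` for odd primes `q ∣ N`) every squarefree `d ∈ [−Y,−4)`, `d ≡ c (mod L)` is in `A_N(Y)` (tree
  `Quadratic.exists_numberField_discr_eq`, `isTotallyComplex_of_discr_neg`, decomposition law); `coprime_of_good_class`;
  **`lower_count_class : #{d ∈ [−Y,−4) : d ≡ c (L), d squarefree} ≥ (3/5)(Y−4)/L − 5√Y`** (the tree's EFFECTIVE squarefree
  count in a coprime class `abs_card_squarefree_modEq_sub_le`, error `5√Y`).

No definition, no named fact, standard axioms; nothing here bears on `L`-values; BSD is not proved; stmt-21381 not closed.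
-/

noncomputable section

open scoped Classical

open Finset
open Literature.NumberTheory.EllipticCurves Literature.NumberTheory.QuadraticFields

namespace Summit.BirchSwinnertonDyer.BirchSwinnertonDyer.Theorems.DisjointDivisibility

/-! ## §1 Numerical constants -/

/-- The squarefree density factor of a modulus is at least `3/5`: `(6/π²)·∏_{q ∣ L}(1 − q⁻²)⁻¹ ≥ 6/π² > 3/5`. [folklore] -/
theorem three_fifths_le_density (L : ℕ) :
    (3 : ℝ) / 5 ≤ 6 / Real.pi ^ 2 * ∏ q ∈ L.primeFactors, (1 - 1 / (q : ℝ) ^ 2)⁻¹ := by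
  have hpi : Real.pi ^ 2 < 10 := by
    have h := Real.pi_lt_d2
    have h0 := Real.pi_pos
    nlinarith
  have h1 : (3 : ℝ) / 5 ≤ 6 / Real.pi ^ 2 := by
    rw [div_le_div_iff₀ (by norm_num) (by positivity)]
    linarith
  have h2 : ∏ _q ∈ L.primeFactors, (1 : ℝ) ≤ ∏ q ∈ L.primeFactors, (1 - 1 / (q : ℝ) ^ 2)⁻¹ := by
    refine Finset.prod_le_prod (fun _ _ => zero_le_one) fun q hq => ?_
    have hq2 : (2 : ℝ) ≤ q := by exact_mod_cast (Nat.prime_of_mem_primeFactors hq).two_le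
    have hlt : (1 : ℝ) / (q : ℝ) ^ 2 < 1 := by
      rw [div_lt_one (by positivity)]; nlinarith
    have hpos : (0 : ℝ) < 1 - 1 / (q : ℝ) ^ 2 := by linarith
    rw [one_le_inv₀ hpos]
    have : (0 : ℝ) ≤ 1 / (q : ℝ) ^ 2 := by positivity
    linarith
  rw [Finset.prod_const_one] at h2
  calc (3 : ℝ) / 5 ≤ 6 / Real.pi ^ 2 * 1 := by rw [mul_one]; exact h1
    _ ≤ _ := by gcongr

/-- **Height bookkeeping.** For `N₀ ≥ 1`, `p ≥ 2` and `Y ≥ (N₀p²)^10`: `14·p·√Y + 1 ≤ (Y − 4)/(8N₀)` (crude: `√Y ≥ N₀⁵p¹⁰`,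
`Y − 4 ≥ Y/2`, `p¹⁰ ≥ 16(14p + 1)`). [folklore] -/
theorem height_ineq {N₀ p Y : ℕ} (hN₀ : 0 < N₀) (hp : 2 ≤ p) (hY : (N₀ * p ^ 2) ^ 10 ≤ Y) :
    14 * (p : ℝ) * Real.sqrt Y + 1 ≤ ((Y : ℝ) - 4) / (8 * N₀) := by
  have hN₀r : (1 : ℝ) ≤ N₀ := by exact_mod_cast hN₀
  have hpr : (2 : ℝ) ≤ p := by exact_mod_cast hp
  -- `√Y ≥ N₀⁵ p¹⁰`
  have hsq : ((N₀ : ℝ) ^ 5 * (p : ℝ) ^ 10) ^ 2 ≤ (Y : ℝ) := by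
    have : ((N₀ * p ^ 2) ^ 10 : ℕ) = (N₀ ^ 5 * p ^ 10) ^ 2 := by ring
    rw [this] at hY
    exact_mod_cast hY
  have hroot : (N₀ : ℝ) ^ 5 * (p : ℝ) ^ 10 ≤ Real.sqrt Y := Real.le_sqrt_of_sq_le hsq
  have hsqrt_nonneg : (0 : ℝ) ≤ Real.sqrt Y := Real.sqrt_nonneg _
  -- `p¹⁰ ≥ 1024`, so `√Y ≥ 1024` and `Y ≥ 8`
  have hp10 : (1024 : ℝ) ≤ (p : ℝ) ^ 10 := by
    calc (1024 : ℝ) = 2 ^ 10 := by norm_num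
      _ ≤ (p : ℝ) ^ 10 := by gcongr
  have hN5 : (1 : ℝ) ≤ (N₀ : ℝ) ^ 5 := one_le_pow₀ hN₀r
  have hN4 : (1 : ℝ) ≤ (N₀ : ℝ) ^ 4 := one_le_pow₀ hN₀r
  have hroot' : (1024 : ℝ) ≤ Real.sqrt Y := by nlinarith
  -- `p¹⁰/16 ≥ 14p + 1`: from `p⁹ ≥ 512` get `p¹⁰ ≥ 512 p ≥ 16(14p+1)`
  have hp9 : (512 : ℝ) ≤ (p : ℝ) ^ 9 := by
    calc (512 : ℝ) = 2 ^ 9 := by norm_num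
      _ ≤ (p : ℝ) ^ 9 := by gcongr
  have hkey : 16 * (14 * (p : ℝ) + 1) ≤ (p : ℝ) ^ 10 := by
    have : (p : ℝ) ^ 10 = (p : ℝ) ^ 9 * p := by ring
    nlinarith
  -- main chain
  rw [le_div_iff₀ (by positivity)]
  -- goal: (14 p √Y + 1) * (8 N₀) ≤ Y - 4
  have h1 : (14 * (p : ℝ) * Real.sqrt Y + 1) * (8 * N₀) ≤ 8 * N₀ * Real.sqrt Y * (14 * p + 1) := by
    nlinarith
  have h2 : 8 * (N₀ : ℝ) * Real.sqrt Y * (14 * p + 1) ≤ (N₀ : ℝ) * Real.sqrt Y * (p : ℝ) ^ 10 / 2 := by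
    nlinarith
  have h3 : (N₀ : ℝ) * Real.sqrt Y * (p : ℝ) ^ 10 / 2 ≤ (Y : ℝ) / 2 := by
    have hN15 : (N₀ : ℝ) ≤ (N₀ : ℝ) ^ 5 := le_self_pow₀ hN₀r (by norm_num)
    have hNp : (N₀ : ℝ) * (p : ℝ) ^ 10 ≤ Real.sqrt Y :=
      le_trans (mul_le_mul_of_nonneg_right hN15 (by positivity)) hroot
    have hY' : Real.sqrt Y * Real.sqrt Y = (Y : ℝ) := Real.mul_self_sqrt (Nat.cast_nonneg Y)
    nlinarith [mul_le_mul_of_nonneg_left hNp hsqrt_nonneg]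
  have h4 : (Y : ℝ) / 2 ≤ (Y : ℝ) - 4 := by
    have : (8 : ℝ) ≤ Y := by nlinarith
    linarith
  linarith

/-! ## §2 The upper family: Heegner discriminants for `N₀` lie in admissible residue classes modulo `8N₀` -/

/-- A member `d` of `A_{N₀}(Y)` reduces modulo `8N₀` to a residue `c` which is admissible (`(c/q) = 1` for every odd prime
`q ∣ N₀`) and `≡ 1 (mod 8)` if `2 ∣ N₀` (decomposition law, `satisfiesHeegnerHypothesis_iff_kronecker`). [folklore] -/
theorem ambient_subset_biUnion (N₀ Y : ℕ) (hN₀ : 0 < N₀) :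
    ambient N₀ Y ⊆ ((Finset.range (8 * N₀)).filter (fun c : ℕ =>
        (∀ q : ℕ, q.Prime → q ∣ N₀ → q ≠ 2 → jacobiSym (c : ℤ) q = 1) ∧ (2 ∣ N₀ → c % 8 = 1))).biUnion
      (fun c : ℕ => (Finset.Ico (-(Y : ℤ)) (-4)).filter (fun d : ℤ => d ≡ (c : ℤ) [ZMOD ((8 * N₀ : ℕ) : ℤ)])) := by
  intro d hd
  obtain ⟨⟨hdY, hd5⟩, K, hF, hNF, hK, hdisc, -, hH⟩ := mem_ambient.1 hd
  have hM : (0 : ℤ) < ((8 * N₀ : ℕ) : ℤ) := by exact_mod_cast (by omega : 0 < 8 * N₀)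
  have hkr := (satisfiesHeegnerHypothesis_iff_kronecker N₀ K hK.1).1 hH
  set c : ℕ := (d % ((8 * N₀ : ℕ) : ℤ)).toNat with hc
  have hc' : (c : ℤ) = d % ((8 * N₀ : ℕ) : ℤ) := Int.toNat_of_nonneg (Int.emod_nonneg _ hM.ne')
  have hdc : d ≡ (c : ℤ) [ZMOD ((8 * N₀ : ℕ) : ℤ)] := by
    rw [Int.ModEq, hc', Int.emod_emod_of_dvd _ dvd_rfl]
  rw [Finset.mem_biUnion]
  refine ⟨c, Finset.mem_filter.2 ⟨Finset.mem_range.2 ?_, ?_, ?_⟩,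
    Finset.mem_filter.2 ⟨Finset.mem_Ico.2 ⟨hdY, by omega⟩, hdc⟩⟩
  · have : (c : ℤ) < ((8 * N₀ : ℕ) : ℤ) := by rw [hc']; exact Int.emod_lt_of_pos _ hM
    exact_mod_cast this
  · intro q hq hqN hq2
    have hq' : (q : ℤ) ∣ ((8 * N₀ : ℕ) : ℤ) := by exact_mod_cast Dvd.dvd.mul_left hqN 8
    have hdcq : (c : ℤ) % q = d % q := by
      have := (hdc.of_dvd hq').symm
      exact this
    rw [jacobiSym.mod_left' hdcq, ← hdisc]
    exact (hkr q hq hqN).2 hq2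
  · intro h2
    have h8 := (hkr 2 Nat.prime_two h2).1 rfl
    rw [hdisc] at h8
    have h8' : (c : ℤ) % 8 = 1 := by
      have h8dvd : (8 : ℤ) ∣ ((8 * N₀ : ℕ) : ℤ) := by exact_mod_cast Dvd.intro N₀ rfl
      have := hdc.of_dvd h8dvd
      rw [Int.ModEq] at this
      rw [← this, h8]
    omega

/-- The admissible classes modulo `8N₀` (with the condition at `2` when `2 ∣ N₀`) number at most `8g`, where `g` counts the
admissible classes with `c ≡ 1 (mod 8)` (odd `N₀`: `card_filter_admissible_le_eight_mul`; even `N₀`: they ARE such). [folklore] -/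
theorem card_admissible_le (N₀ : ℕ) :
    ((Finset.range (8 * N₀)).filter (fun c : ℕ =>
        (∀ q : ℕ, q.Prime → q ∣ N₀ → q ≠ 2 → jacobiSym (c : ℤ) q = 1) ∧ (2 ∣ N₀ → c % 8 = 1))).card ≤
    8 * ((Finset.range (8 * N₀)).filter (fun c : ℕ => c % 8 = 1 ∧
        ∀ q : ℕ, q.Prime → q ∣ N₀ → q ≠ 2 → jacobiSym (c : ℤ) q = 1)).card := by
  rcases Nat.even_or_odd N₀ with heven | hodd
  · have h2 : 2 ∣ N₀ := even_iff_two_dvd.1 heven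
    calc _ ≤ ((Finset.range (8 * N₀)).filter (fun c : ℕ => c % 8 = 1 ∧
          ∀ q : ℕ, q.Prime → q ∣ N₀ → q ≠ 2 → jacobiSym (c : ℤ) q = 1)).card := by
          refine Finset.card_le_card fun c hc => ?_
          rw [Finset.mem_filter] at hc ⊢
          exact ⟨hc.1, hc.2.2 h2, hc.2.1⟩
      _ ≤ _ := Nat.le_mul_of_pos_left _ (by norm_num)
  · calc _ ≤ ((Finset.range (8 * N₀)).filter (fun c : ℕ =>
          ∀ q : ℕ, q.Prime → q ∣ N₀ → q ≠ 2 → jacobiSym (c : ℤ) q = 1)).card := by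
          refine Finset.card_le_card fun c hc => ?_
          rw [Finset.mem_filter] at hc ⊢
          exact ⟨hc.1, hc.2.1⟩
      _ ≤ _ := card_filter_admissible_le_eight_mul hodd

/-- **Upper count.** `#A_{N₀}(Y) ≤ 8g·((Y − 4)/(8N₀) + 1)` with `g` the number of admissible classes `c ≡ 1 (mod 8)` modulo
`8N₀` (each residue class meets `[−Y, −4)` in at most `(Y−4)/(8N₀) + 1` integers). [folklore] -/
theorem card_ambient_le (N₀ Y : ℕ) (hN₀ : 0 < N₀) (hY : 4 ≤ Y) :
    ((ambient N₀ Y).card : ℝ) ≤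
      8 * ((Finset.range (8 * N₀)).filter (fun c : ℕ => c % 8 = 1 ∧
        ∀ q : ℕ, q.Prime → q ∣ N₀ → q ≠ 2 → jacobiSym (c : ℤ) q = 1)).card *
      (((Y : ℝ) - 4) / (8 * N₀) + 1) := by
  set G := (Finset.range (8 * N₀)).filter (fun c : ℕ =>
        (∀ q : ℕ, q.Prime → q ∣ N₀ → q ≠ 2 → jacobiSym (c : ℤ) q = 1) ∧ (2 ∣ N₀ → c % 8 = 1)) with hG
  have hM : (0 : ℤ) < ((8 * N₀ : ℕ) : ℤ) := by exact_mod_cast (by omega : 0 < 8 * N₀)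
  have hab : (-(Y : ℤ)) ≤ -4 := by omega
  have hclass : ∀ c ∈ G,
      ((((Finset.Ico (-(Y : ℤ)) (-4)).filter (fun d : ℤ => d ≡ (c : ℤ) [ZMOD ((8 * N₀ : ℕ) : ℤ)])).card : ℕ) : ℝ)
        ≤ ((Y : ℝ) - 4) / (8 * N₀) + 1 := by
    intro c _
    have h := abs_card_Ico_filter_modEq_sub_le hab hM (c : ℤ)
    have h' := (abs_le.1 h).2
    have hmain : (((-4 : ℤ) : ℝ) - ((-(Y : ℤ) : ℤ) : ℝ)) / ((((8 * N₀ : ℕ) : ℤ) : ℝ)) =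
        ((Y : ℝ) - 4) / (8 * N₀) := by push_cast; ring
    linarith [hmain]
  calc ((ambient N₀ Y).card : ℝ)
      ≤ ((G.biUnion (fun c : ℕ => (Finset.Ico (-(Y : ℤ)) (-4)).filter
          (fun d : ℤ => d ≡ (c : ℤ) [ZMOD ((8 * N₀ : ℕ) : ℤ)]))).card : ℝ) := by
        exact_mod_cast Finset.card_le_card (ambient_subset_biUnion N₀ Y hN₀)
    _ ≤ ∑ c ∈ G, ((((Finset.Ico (-(Y : ℤ)) (-4)).filter
          (fun d : ℤ => d ≡ (c : ℤ) [ZMOD ((8 * N₀ : ℕ) : ℤ)])).card : ℕ) : ℝ) := by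
        exact_mod_cast Finset.card_biUnion_le
    _ ≤ ∑ _c ∈ G, (((Y : ℝ) - 4) / (8 * N₀) + 1) := Finset.sum_le_sum hclass
    _ = (G.card : ℝ) * (((Y : ℝ) - 4) / (8 * N₀) + 1) := by rw [Finset.sum_const, nsmul_eq_mul]
    _ ≤ _ := by
        have hg := card_admissible_le N₀
        have hg' : (G.card : ℝ) ≤ 8 * ((Finset.range (8 * N₀)).filter (fun c : ℕ => c % 8 = 1 ∧
            ∀ q : ℕ, q.Prime → q ∣ N₀ → q ≠ 2 → jacobiSym (c : ℤ) q = 1)).card := by exact_mod_cast hg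
        have hpos : (0 : ℝ) ≤ ((Y : ℝ) - 4) / (8 * N₀) + 1 := by
          have : (4 : ℝ) ≤ Y := by exact_mod_cast hY
          positivity
        exact mul_le_mul_of_nonneg_right hg' hpos

/-! ## §3 The lower family: squarefree `d ≡ c (mod L)` in good classes are Heegner discriminants -/

/-- A squarefree negative `d ≡ 1 (mod 8)` is the discriminant of an imaginary quadratic field. [folklore] -/
theorem exists_field_of_squarefree_mod_eight {d : ℤ} (hd8 : d % 8 = 1) (hsq : Squarefree d) (hd0 : d < 0) :
    ∃ (K : Type) (_ : Field K) (_ : NumberField K), IsImaginaryQuadratic K ∧ NumberField.discr K = d := by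
  have hfund : (d % 4 = 1 ∧ Squarefree d ∧ d ≠ 1) ∨
      (4 ∣ d ∧ (d / 4 % 4 = 2 ∨ d / 4 % 4 = 3) ∧ Squarefree (d / 4)) := Or.inl ⟨by omega, hsq, by omega⟩
  obtain ⟨K, hF, hNF, h2, hdisc⟩ := Quadratic.exists_numberField_discr_eq hfund
  exact ⟨K, hF, hNF, ⟨h2, Quadratic.isTotallyComplex_of_discr_neg h2 (hdisc ▸ hd0)⟩, hdisc⟩

/-- **Lower family membership.** Let `8 ∣ L` and let `c` be a GOOD class for the level `N` modulo `L`: `c ≡ 1 (mod 8)` and,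
for every odd prime `q ∣ N`, `q ∣ L` and `(c/q) = 1`. Then every squarefree `d ∈ [−Y, −4)` with `d ≡ c (mod L)` lies in
`A_N(Y)` (existence of `ℚ(√d)` for `d ≡ 1 (8)` squarefree; decomposition law at every prime of `N`). [folklore] -/
theorem filter_modEq_squarefree_subset_ambient (N L Y c : ℕ) (h8 : 8 ∣ L) (hc8 : c % 8 = 1)
    (hJ : ∀ q : ℕ, q.Prime → q ∣ N → q ≠ 2 → q ∣ L ∧ jacobiSym (c : ℤ) q = 1) :
    (Finset.Ico (-(Y : ℤ)) (-4)).filter (fun d : ℤ => d ≡ (c : ℤ) [ZMOD (L : ℤ)] ∧ Squarefree d)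
      ⊆ ambient N Y := by
  intro d hd
  rw [Finset.mem_filter, Finset.mem_Ico] at hd
  obtain ⟨⟨hdY, hd4⟩, hdc, hsq⟩ := hd
  have h8dvd : (8 : ℤ) ∣ (L : ℤ) := by exact_mod_cast h8
  have hd8 : d % 8 = 1 := by
    have := hdc.of_dvd h8dvd
    rw [Int.ModEq] at this
    rw [this]
    have hc : ((c : ℤ) % 8) = ((c % 8 : ℕ) : ℤ) := by push_cast; rfl
    rw [hc, hc8]; rfl
  obtain ⟨K, hF, hNF, hK, hdisc⟩ := exists_field_of_squarefree_mod_eight hd8 hsq (by omega)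
  rw [mem_ambient]
  refine ⟨⟨hdY, by omega⟩, K, hF, hNF, hK, hdisc, by omega, ?_⟩
  rw [satisfiesHeegnerHypothesis_iff_kronecker N K hK.1, hdisc]
  intro q hq hqN
  refine ⟨fun _ => hd8, fun hq2 => ?_⟩
  obtain ⟨hqL, hval⟩ := hJ q hq hqN hq2
  have hq' : (q : ℤ) ∣ (L : ℤ) := by exact_mod_cast hqL
  have hdcq : d % q = (c : ℤ) % q := hdc.of_dvd hq'
  rw [jacobiSym.mod_left' hdcq]
  exact hval

/-- A good class is coprime to the modulus: `c ≡ 1 (mod 8)` with `(c/q) = 1` at every odd prime `q ∣ L` has `gcd(c, L) = 1`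
(an odd prime `q ∣ c` would give `(c/q) = 0`). [folklore] -/
theorem coprime_of_good_class {L c : ℕ} (hc8 : c % 8 = 1)
    (hJL : ∀ q : ℕ, q.Prime → q ∣ L → q ≠ 2 → jacobiSym (c : ℤ) q = 1) : Nat.Coprime c L := by
  refine Nat.coprime_of_dvd fun k hk hkc hkL => ?_
  by_cases hk2 : k = 2
  · subst hk2; omega
  have hval : jacobiSym (c : ℤ) k = 1 := hJL k hk hkL hk2
  have hzero : jacobiSym (c : ℤ) k = 0 := by
    rw [jacobiSym.eq_zero_iff]
    refine ⟨hk.ne_zero, ?_⟩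
    rw [Int.gcd_natCast_natCast]
    intro h1
    have := Nat.dvd_gcd hkc (dvd_refl k)
    rw [h1] at this
    exact hk.one_lt.ne' (Nat.dvd_one.1 this)
  rw [hzero] at hval
  exact absurd hval (by norm_num)

/-- **Lower count per class.** For a good class `c` modulo `L ≥ 1` (`c ≡ 1 (8)`, `(c/q) = 1` for odd primes `q ∣ L`) and
`Y ≥ 4`: `#{d ∈ [−Y, −4) : d ≡ c (mod L), d squarefree} ≥ (3/5)(Y − 4)/L − 5√Y` (the tree's effective squarefree count in a
coprime class, `abs_card_squarefree_modEq_sub_le`, with density factor `≥ 3/5`). [folklore] -/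
theorem lower_count_class {L c Y : ℕ} (hL : 0 < L) (hY : 4 ≤ Y) (hc8 : c % 8 = 1)
    (hJL : ∀ q : ℕ, q.Prime → q ∣ L → q ≠ 2 → jacobiSym (c : ℤ) q = 1) :
    (3 : ℝ) / 5 * (((Y : ℝ) - 4) / (L : ℝ)) - 5 * Real.sqrt Y ≤
      (((Finset.Ico (-(Y : ℤ)) (-4)).filter (fun d : ℤ =>
        d ≡ (c : ℤ) [ZMOD (L : ℤ)] ∧ Squarefree d)).card : ℝ) := by
  have hgcd : Int.gcd (c : ℤ) (L : ℤ) = 1 := by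
    rw [Int.gcd_natCast_natCast]
    exact coprime_of_good_class hc8 hJL
  have h := abs_card_squarefree_modEq_sub_le hL hgcd (a := -(Y : ℤ)) (b := -4) (by omega)
    (Or.inl (by norm_num)) (M := Y) (by simp) (by simp; omega)
  have h' := (abs_le.1 h).1
  have hdens := three_fifths_le_density L
  have hlen : (0 : ℝ) ≤ ((-4 : ℤ) : ℝ) - ((-(Y : ℤ) : ℤ) : ℝ) := by
    push_cast
    have : (4 : ℝ) ≤ Y := by exact_mod_cast hY
    linarith
  have hmain : (3 : ℝ) / 5 * (((Y : ℝ) - 4) / (L : ℝ)) ≤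
      (((-4 : ℤ) : ℝ) - ((-(Y : ℤ) : ℤ) : ℝ)) / (L : ℝ) *
        (6 / Real.pi ^ 2 * ∏ q ∈ L.primeFactors, (1 - 1 / (q : ℝ) ^ 2)⁻¹) := by
    have hq : (0 : ℝ) ≤ (((-4 : ℤ) : ℝ) - ((-(Y : ℤ) : ℤ) : ℝ)) / (L : ℝ) := by positivity
    calc (3 : ℝ) / 5 * (((Y : ℝ) - 4) / (L : ℝ))
        = (((-4 : ℤ) : ℝ) - ((-(Y : ℤ) : ℤ) : ℝ)) / (L : ℝ) * (3 / 5) := by push_cast; ring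
      _ ≤ _ := mul_le_mul_of_nonneg_left hdens hq
  linarith


end Summit.BirchSwinnertonDyer.BirchSwinnertonDyer.Theorems.DisjointDivisibility

end
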